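import Summits.ResolutionOfSingularities.ResolutionOfSingularities.Theorems.FrobeniusLadderFInjectiveMacaulayficationFedderAtMaximalIdeal
import Summits.ResolutionOfSingularities.ResolutionOfSingularities.Theorems.FrobeniusLadderFInjectiveMacaulayficationCIFedderClosure
import Literature.AlgebraicGeometry.Resolution.AffineDomainEquidim
import Mathlib.RingTheory.KrullDimension.Zero
import Mathlib.RingTheory.Ideal.Height
import HarnessLib

/-!
# Fedder's test for complete intersections at an arbitrary closed point of affine space

Support file for crux stmt-ResolutionOfSingularities-15315 (`FrobeniusLadder.FInjectiveMacaulayfication`),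
chain w45a, seat res-L1-w45a-stub-6 (res-D-pv-018, D→L convert), file 4 of the CI-CN engine kernel
(res-L1-w45a-plan-1 R8.4: the chart form). [OURS · L1 W4.5a] — NOT a statement of the manuscript
[claim: Hironaka2017]; AI-written, weaker than expert review.

`…FedderAtMaximalIdeal.lean` certifies the crux's per-stalk clause at a closed point of a HYPERSURFACE
`k[y]/(g)` from the polynomial-level test `g^(p-1) ∉ (a₁^p, …, a_m^p)` (`(aᵢ)` = the point's maximal ideal).
This file is the COMPLETE-INTERSECTION version consumed by the CI-CN engine (idea-1 card 4; CRUX-PLAN v8 §2):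
for `S = k[y₀, …, y_{n-1}]`, a finite list `gs ⊆ S` of local equations and a maximal ideal `Q` of `S/(gs)`
contracting to `P = (a₁, …, a_m)`:

* §1 `nonempty_quotLocalizationEquiv` — `S_P ⧸ I·S_P ≃+* (S/I)_Q` for any ideal `I` and prime `Q` of `S/I`
  over `P` (`QuotLocalizationIso.stub_quotLocalizationIso` with `(u)` ↦ `I`).
* §2 `ringKrullDim_quotient_ofList_of_sop_certificate` — in a Noetherian local ring `(R, 𝔪)` of dimension
  `|gs| + |hs|`, if `𝔪^N ⊆ (gs ++ hs)` then `dim R⧸(gs) = |hs|` (Krull's height theorem twice,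
  `ringKrullDim_le_ringKrullDim_quotient_add_card`): the EXPECTED-DIMENSION certificate in system-of-parameters
  form.
* §3 `ci_fedderAtMaximalIdeal` — if `(∏ gs)^(p-1) ∉ (a₁^p, …, a_m^p)` and `dim (S/(gs))_Q + |gs| = n`, then
  `(S/(gs))_Q` satisfies the per-stalk clause of the crux (every system of parameters weakly regular and
  generating a Frobenius closed ideal): `CIFedder.fedder_ci_clause` in the regular local ring `S_P`
  (`dim S_P = n`, `MvPolynomial.height_eq_of_isMaximal`), the test moved to `S` by
  `FedderAtMaximalIdeal.algebraMap_pow_mem_frobeniusPower_maximalIdeal_iff`, transport along §1.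
* §4 `ringKrullDim_stalk_add_length_of_sop_certificate`, `ci_fedderAtMaximalIdeal_of_certificate` — the
  dimension binder discharged by a polynomial-level certificate `P^N ⊆ (gs ++ hs)`, `|gs| + |hs| = n`.

No definitions, no named facts; glue. [folklore]
-/

-- single-problem summit: the doubled namespace component is forced
set_option linter.dupNamespace false

namespace Summit.ResolutionOfSingularities.ResolutionOfSingularities.Theorems.FInjectiveMacaulayfication.CIFedderAtMaximalIdeal

open MvPolynomial IsLocalRing RingTheory.Sequence Literature.RingTheory.TightClosure
  Literature.AlgebraicGeometry.Resolution
open Summit.ResolutionOfSingularities.ResolutionOfSingularities.Theorems.FInjectiveMacaulayfication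

/-! ## §1 Localization commutes with quotients (any ideal) -/

/-- **`A_Q ⧸ I·A_Q ≃+* (A/I)_{Q'}`** for an ideal `I` of `A` and a prime `Q'` of `A ⧸ I` with contraction
`Q = Q'.comap mk`: `A_Q ⧸ I·A_Q` is the localization of `A ⧸ I` at the image of `A ∖ Q`, which is
`(A ⧸ I) ∖ Q'` (`QuotLocalizationIso.algebraMapSubmonoid_primeCompl_comap`); uniqueness of localizations.
[folklore] -/
-- adapted from `QuotLocalizationIso.stub_quotLocalizationIso` (the principal case `I = (u)`)
theorem nonempty_quotLocalizationEquiv (A : Type) [CommRing A] (I : Ideal A) (Q' : Ideal (A ⧸ I))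
    [Q'.IsPrime] :
    Nonempty ((Localization.AtPrime (Q'.comap (Ideal.Quotient.mk I)) ⧸
      I.map (algebraMap A (Localization.AtPrime (Q'.comap (Ideal.Quotient.mk I))))) ≃+*
        Localization.AtPrime Q') := by
  have hL : IsLocalization Q'.primeCompl
      (Localization.AtPrime (Q'.comap (Ideal.Quotient.mk I)) ⧸
        I.map (algebraMap A (Localization.AtPrime (Q'.comap (Ideal.Quotient.mk I))))) := by
    rw [← QuotLocalizationIso.algebraMapSubmonoid_primeCompl_comap I Q']
    infer_instance
  exact ⟨(IsLocalization.algEquiv Q'.primeCompl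
    (Localization.AtPrime (Q'.comap (Ideal.Quotient.mk I)) ⧸
      I.map (algebraMap A (Localization.AtPrime (Q'.comap (Ideal.Quotient.mk I)))))
    (Localization.AtPrime Q')).toRingEquiv⟩

/-! ## §2 The expected-dimension certificate in a Noetherian local ring -/

/-- The ideal of a list is the span of its finset. [folklore] -/
theorem ofList_eq_span_toFinset {R : Type*} [CommRing R] [DecidableEq R] (L : List R) :
    Ideal.ofList L = Ideal.span (L.toFinset : Set R) := by
  rw [List.coe_toFinset]

/-- A quotient of a local ring by an ideal containing a power of the maximal ideal (and proper) has Krull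
dimension `0`. [folklore] -/
theorem ringKrullDim_quotient_eq_zero_of_pow_le {R : Type*} [CommRing R] [IsLocalRing R] {J : Ideal R}
    (hJ : J ≠ ⊤) {N : ℕ} (hN : maximalIdeal R ^ N ≤ J) : ringKrullDim (R ⧸ J) = 0 := by
  haveI : Nontrivial (R ⧸ J) := Ideal.Quotient.nontrivial_iff.mpr hJ
  haveI : Ring.KrullDimLE 0 (R ⧸ J) := by
    refine Ideal.krullDimLE_zero_quotient_iff_forall_minimalPrimes_isMaximal.mpr fun P hP => ?_
    haveI : P.IsPrime := hP.1.1
    have hmP : maximalIdeal R ≤ P :=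
      (Ideal.IsPrime.pow_le_iff (I := maximalIdeal R) (hn := ?_)).mp (hN.trans hP.1.2)
    · rw [← (maximalIdeal.isMaximal R).eq_of_le (Ideal.IsPrime.ne_top inferInstance) hmP]
      exact maximalIdeal.isMaximal R
    · -- `N ≠ 0`: otherwise `J = ⊤`
      rintro rfl
      exact hJ (top_le_iff.mp (by simpa only [pow_zero, Ideal.one_eq_top] using hN))
  exact ringKrullDimZero_iff_ringKrullDim_eq_zero.mp inferInstance

/-- **EXPECTED DIMENSION FROM A SYSTEM-OF-PARAMETERS CERTIFICATE.** Let `(R, 𝔪)` be a Noetherian local ring of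
dimension `|gs| + |hs|` with `gs, hs ⊆ 𝔪` and `𝔪^N ⊆ (gs ++ hs)` for some `N`. Then `dim R⧸(gs) = |hs|`:
`≥` by Krull's height theorem for `R → R⧸(gs)` (`dim R ≤ dim R⧸(gs) + |gs|`), `≤` by the same for
`R⧸(gs) → R⧸(gs ++ hs)`, the latter of dimension `0`. [folklore] -/
theorem ringKrullDim_quotient_ofList_of_sop_certificate {R : Type} [CommRing R] [IsNoetherianRing R]
    [IsLocalRing R] (gs hs : List R) (hgs : ∀ g ∈ gs, g ∈ maximalIdeal R)
    (hhs : ∀ h ∈ hs, h ∈ maximalIdeal R) (hdim : ringKrullDim R = ((gs.length + hs.length : ℕ) : WithBot ℕ∞))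
    {N : ℕ} (hN : maximalIdeal R ^ N ≤ Ideal.ofList (gs ++ hs)) :
    ringKrullDim (R ⧸ Ideal.ofList gs) = (hs.length : WithBot ℕ∞) := by
  classical
  obtain ⟨hne, hnt, hloc⟩ := CIChartCore.isLocalRing_quotient_ofList gs hgs
  set T := R ⧸ Ideal.ofList gs
  set mk := Ideal.Quotient.mk (Ideal.ofList gs)
  obtain ⟨t, ht⟩ := exists_nat_cast_eq_ringKrullDim (R := T)
  have hjacR : Ring.jacobson R = maximalIdeal R := ringJacobson_eq_maximalIdeal R
  have hjacT : Ring.jacobson T = maximalIdeal T := ringJacobson_eq_maximalIdeal T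
  have hmaxT : (maximalIdeal R).map mk = maximalIdeal T :=
    map_maximalIdeal_of_surjective mk Ideal.Quotient.mk_surjective
  -- (≥): `dim R ≤ dim T + |gs|`
  have h1 : ringKrullDim R ≤ ringKrullDim T + gs.toFinset.card := by
    have h := ringKrullDim_le_ringKrullDim_quotient_add_card (R := R) gs.toFinset
      (by rw [hjacR, List.coe_toFinset]; exact fun x hx => hgs x hx)
    rwa [← ofList_eq_span_toFinset] at h
  have h1' : gs.length + hs.length ≤ t + gs.length := by
    have hc : ((gs.toFinset.card : ℕ) : WithBot ℕ∞) ≤ (gs.length : WithBot ℕ∞) :=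
      Nat.cast_le.mpr (List.toFinset_card_le gs)
    have h := h1.trans (add_le_add le_rfl hc)
    rw [hdim, ht] at h
    exact_mod_cast h
  -- (≤): `dim T ≤ dim T⧸(hs) + |hs|` and `T ⧸ (hs) ≅ R ⧸ (gs ++ hs)` has dimension `0`
  have hJne : Ideal.ofList (gs ++ hs) ≠ ⊤ := (CIChartCore.isLocalRing_quotient_ofList (gs ++ hs) (by
    intro x hx
    rcases List.mem_append.mp hx with hx | hx
    · exact hgs x hx
    · exact hhs x hx)).1
  have h0 : ringKrullDim (T ⧸ Ideal.ofList (hs.map mk)) = 0 := by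
    have e : (T ⧸ Ideal.ofList (hs.map mk)) ≃+* R ⧸ Ideal.ofList (gs ++ hs) :=
      ((Ideal.quotEquivOfEq (Ideal.map_ofList mk hs).symm).trans
        (DoubleQuot.quotQuotEquivQuotSup (Ideal.ofList gs) (Ideal.ofList hs))).trans
        (Ideal.quotEquivOfEq (Ideal.ofList_append gs hs).symm)
    rw [ringKrullDim_eq_of_ringEquiv e]
    exact ringKrullDim_quotient_eq_zero_of_pow_le hJne hN
  have h2 : ringKrullDim T ≤ ringKrullDim (T ⧸ Ideal.ofList (hs.map mk)) + (hs.map mk).toFinset.card := by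
    have h := ringKrullDim_le_ringKrullDim_quotient_add_card (R := T) (hs.map mk).toFinset (by
      rw [hjacT, List.coe_toFinset, ← hmaxT]
      intro x hx
      obtain ⟨y, hy, rfl⟩ := List.mem_map.mp hx
      exact Ideal.mem_map_of_mem mk (hhs y hy))
    rwa [← ofList_eq_span_toFinset] at h
  have h2' : t ≤ hs.length := by
    have hc : (((hs.map mk).toFinset.card : ℕ) : WithBot ℕ∞) ≤ (hs.length : WithBot ℕ∞) :=
      Nat.cast_le.mpr ((List.toFinset_card_le _).trans (List.length_map _).le)
    have h := h2.trans (add_le_add le_rfl hc)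
    rw [h0, ht, zero_add] at h
    exact_mod_cast h
  have hth : t = hs.length := le_antisymm h2' (by omega)
  rw [← hth]
  exact ht

/-! ## §3 The complete-intersection Fedder test at a closed point of `𝔸ⁿ` -/

section MaximalIdeal

variable (k : Type) [Field k] (n m : ℕ) (p : ℕ) [Fact p.Prime] [CharP k p]

/-- **FEDDER'S TEST FOR A COMPLETE INTERSECTION AT AN ARBITRARY CLOSED POINT.** For a field `k` of
characteristic `p`, `S = k[y₀, …, y_{n-1}]`, a finite list `gs ⊆ S` and a maximal ideal `Q` of `S ⧸ (gs)` whose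
contraction to `S` is generated by `a₁, …, a_m`: if `(∏ gs)^(p-1) ∉ (a₁^p, …, a_m^p)` and
`dim (S⧸(gs))_Q + |gs| = n` (expected dimension), then the local ring `(S ⧸ (gs))_Q` satisfies the per-stalk
clause of `FrobeniusLadder.FInjectiveMacaulayfication`: every system of parameters is weakly regular and
generates a Frobenius closed ideal. (`CIFedder.fedder_ci_clause` in the regular local ring `S_P`,
`P = Q ∩ S`, `dim S_P = n`; the test moved to `S` by
`FedderAtMaximalIdeal.algebraMap_pow_mem_frobeniusPower_maximalIdeal_iff`; transport along
`S_P ⧸ (gs) ≅ (S⧸(gs))_Q`.) [cite: Fedder1983, Prop. 1.7, Thm. 1.12 and Prop. 2.1] -/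
theorem ci_fedderAtMaximalIdeal (a : Fin m → MvPolynomial (Fin n) k) (gs : List (MvPolynomial (Fin n) k))
    (Q : Ideal (MvPolynomial (Fin n) k ⧸ Ideal.ofList gs)) [Q.IsMaximal]
    (hQ : Q.comap (Ideal.Quotient.mk (Ideal.ofList gs)) = Ideal.span (Set.range a))
    (hfed : gs.prod ^ (p - 1) ∉ Ideal.span (Set.range fun i : Fin m => a i ^ p))
    (hdim : ringKrullDim (Localization.AtPrime Q) + (gs.length : WithBot ℕ∞) = (n : WithBot ℕ∞)) :
    ∀ d : ℕ, ringKrullDim (Localization.AtPrime Q) = d → ∀ s : Fin d → Localization.AtPrime Q,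
      (Ideal.span (Set.range s)).radical.IsMaximal →
        RingTheory.Sequence.IsWeaklyRegular (Localization.AtPrime Q) (List.ofFn s) ∧
        ∀ y : Localization.AtPrime Q, (∃ e : ℕ, y ^ p ^ e ∈ Ideal.span
          ((fun z : Localization.AtPrime Q => z ^ p ^ e) ''
            (Ideal.span (Set.range s) : Set (Localization.AtPrime Q)))) → y ∈ Ideal.span (Set.range s) := by
  -- `P = Q ∩ S` is maximal; `R = S_P` is regular local of characteristic `p` and dimension `n`
  haveI hPmax : (Q.comap (Ideal.Quotient.mk (Ideal.ofList gs))).IsMaximal :=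
    Ideal.comap_isMaximal_of_surjective _ Ideal.Quotient.mk_surjective
  set P : Ideal (MvPolynomial (Fin n) k) := Q.comap (Ideal.Quotient.mk (Ideal.ofList gs)) with hP_def
  set R := Localization.AtPrime P
  haveI : IsRegularLocalRing R := IsRegularRing.isRegularLocalRing_localization P
  have hinj : Function.Injective (algebraMap (MvPolynomial (Fin n) k) R) :=
    IsLocalization.injective R P.primeCompl_le_nonZeroDivisors
  haveI : CharP R p := charP_of_injective_algebraMap hinj p
  have hdimR : ringKrullDim R = (n : WithBot ℕ∞) := by
    rw [IsLocalization.AtPrime.ringKrullDim_eq_height P R, MvPolynomial.height_eq_of_isMaximal k n P]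
    rfl
  -- the local equations upstairs
  set gs' : List R := gs.map (algebraMap (MvPolynomial (Fin n) k) R) with hgs'_def
  have hgsP : ∀ g ∈ gs, g ∈ P := by
    intro g hg
    rw [hP_def, Ideal.mem_comap,
      Ideal.Quotient.eq_zero_iff_mem.mpr (Ideal.subset_span (show g ∈ {r | r ∈ gs} from hg))]
    exact Q.zero_mem
  have hgs'm : ∀ g ∈ gs', g ∈ maximalIdeal R := by
    intro g hg
    obtain ⟨g₀, hg₀, rfl⟩ := List.mem_map.mp hg
    rw [← IsLocalization.AtPrime.map_eq_maximalIdeal P R]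
    exact Ideal.mem_map_of_mem _ (hgsP g₀ hg₀)
  -- Fedder's test upstairs
  have hfed' : gs'.prod ^ (p - 1) ∉ frobeniusPower p (maximalIdeal R) := by
    rw [hgs'_def, ← map_list_prod,
      FedderAtMaximalIdeal.algebraMap_pow_mem_frobeniusPower_maximalIdeal_iff k n m p P a hQ]
    exact hfed
  -- `R ⧸ (gs') ≅ (S ⧸ (gs))_Q`
  have hmap : Ideal.ofList gs' = (Ideal.ofList gs).map (algebraMap (MvPolynomial (Fin n) k) R) := by
    rw [hgs'_def, Ideal.map_ofList]
  obtain ⟨e₀⟩ := nonempty_quotLocalizationEquiv (MvPolynomial (Fin n) k) (Ideal.ofList gs) Q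
  have e₁ : (R ⧸ Ideal.ofList gs') ≃+* Localization.AtPrime Q := (Ideal.quotEquivOfEq hmap).trans e₀
  -- dimension bookkeeping upstairs
  have hdim' : ringKrullDim (R ⧸ Ideal.ofList gs') + (gs'.length : WithBot ℕ∞) = ringKrullDim R := by
    rw [ringKrullDim_eq_of_ringEquiv (R := R ⧸ Ideal.ofList gs') (S := Localization.AtPrime Q) e₁,
      hgs'_def, List.length_map, hdimR, hdim]
  -- Fedder for complete intersections upstairs, then transport
  obtain ⟨hF, hW⟩ := CIFedder.fedder_ci_clause p R gs' hgs'm hfed' hdim'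
  exact DegreeZeroDescent.inlineClause_of_ringEquiv (L := R ⧸ Ideal.ofList gs')
    (L' := Localization.AtPrime Q) p e₁ (fun d hd s hs => ⟨hW d hd s hs, fun y hy => hF _ y hy⟩)

/-! ## §4 The dimension binder from a polynomial-level certificate -/

/-- **The expected dimension of a complete intersection at a closed point, from an s.o.p. certificate in
`k[y]`.** With `S`, `gs`, `Q`, `P = (a₁, …, a_m)` as above: if `hs ⊆ P` is a further list with
`|gs| + |hs| = n` and `P^N ⊆ (gs ++ hs)` for some `N` (i.e. `(gs, hs)` is a system of parameters of `S_P`),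
then `dim (S⧸(gs))_Q + |gs| = n`. (`ringKrullDim_quotient_ofList_of_sop_certificate` in `S_P`, transport
along `S_P ⧸ (gs) ≅ (S⧸(gs))_Q`.) [folklore] -/
theorem ringKrullDim_stalk_add_length_of_sop_certificate (a : Fin m → MvPolynomial (Fin n) k)
    (gs hs : List (MvPolynomial (Fin n) k)) (Q : Ideal (MvPolynomial (Fin n) k ⧸ Ideal.ofList gs))
    [Q.IsMaximal] (hQ : Q.comap (Ideal.Quotient.mk (Ideal.ofList gs)) = Ideal.span (Set.range a))
    (hhs : ∀ h ∈ hs, h ∈ Ideal.span (Set.range a)) (hlen : gs.length + hs.length = n) (N : ℕ)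
    (hN : Ideal.span (Set.range a) ^ N ≤ Ideal.ofList (gs ++ hs)) :
    ringKrullDim (Localization.AtPrime Q) + (gs.length : WithBot ℕ∞) = (n : WithBot ℕ∞) := by
  have hhsP : ∀ h ∈ hs, h ∈ Q.comap (Ideal.Quotient.mk (Ideal.ofList gs)) := by
    rw [hQ]; exact hhs
  have hNP : (Q.comap (Ideal.Quotient.mk (Ideal.ofList gs))) ^ N ≤ Ideal.ofList (gs ++ hs) := by
    rw [hQ]; exact hN
  haveI hPmax : (Q.comap (Ideal.Quotient.mk (Ideal.ofList gs))).IsMaximal :=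
    Ideal.comap_isMaximal_of_surjective _ Ideal.Quotient.mk_surjective
  set P : Ideal (MvPolynomial (Fin n) k) := Q.comap (Ideal.Quotient.mk (Ideal.ofList gs)) with hP_def
  set R := Localization.AtPrime P
  have hdimR : ringKrullDim R = (n : WithBot ℕ∞) := by
    rw [IsLocalization.AtPrime.ringKrullDim_eq_height P R, MvPolynomial.height_eq_of_isMaximal k n P]
    rfl
  have hmR : maximalIdeal R = P.map (algebraMap (MvPolynomial (Fin n) k) R) :=
    (IsLocalization.AtPrime.map_eq_maximalIdeal P R).symm
  have hgsP : ∀ g ∈ gs, g ∈ P := by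
    intro g hg
    rw [hP_def, Ideal.mem_comap,
      Ideal.Quotient.eq_zero_iff_mem.mpr (Ideal.subset_span (show g ∈ {r | r ∈ gs} from hg))]
    exact Q.zero_mem
  set gs' : List R := gs.map (algebraMap (MvPolynomial (Fin n) k) R) with hgs'_def
  set hs' : List R := hs.map (algebraMap (MvPolynomial (Fin n) k) R) with hhs'_def
  have hgs'm : ∀ g ∈ gs', g ∈ maximalIdeal R := by
    intro g hg
    obtain ⟨g₀, hg₀, rfl⟩ := List.mem_map.mp hg
    rw [hmR]
    exact Ideal.mem_map_of_mem _ (hgsP g₀ hg₀)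
  have hhs'm : ∀ h ∈ hs', h ∈ maximalIdeal R := by
    intro h hh
    obtain ⟨h₀, hh₀, rfl⟩ := List.mem_map.mp hh
    rw [hmR]
    exact Ideal.mem_map_of_mem _ (hhsP h₀ hh₀)
  have hdimR' : ringKrullDim R = ((gs'.length + hs'.length : ℕ) : WithBot ℕ∞) := by
    rw [hgs'_def, hhs'_def, List.length_map, List.length_map, hlen, hdimR]
  have hN' : maximalIdeal R ^ N ≤ Ideal.ofList (gs' ++ hs') := by
    rw [hmR, ← Ideal.map_pow, hgs'_def, hhs'_def, ← List.map_append, ← Ideal.map_ofList]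
    exact Ideal.map_mono hNP
  have hq := ringKrullDim_quotient_ofList_of_sop_certificate gs' hs' hgs'm hhs'm hdimR' hN'
  -- transport along `R ⧸ (gs') ≅ (S ⧸ (gs))_Q`
  have hmap : Ideal.ofList gs' = (Ideal.ofList gs).map (algebraMap (MvPolynomial (Fin n) k) R) := by
    rw [hgs'_def, Ideal.map_ofList]
  obtain ⟨e₀⟩ := nonempty_quotLocalizationEquiv (MvPolynomial (Fin n) k) (Ideal.ofList gs) Q
  have e₁ : (R ⧸ Ideal.ofList gs') ≃+* Localization.AtPrime Q := (Ideal.quotEquivOfEq hmap).trans e₀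
  rw [← ringKrullDim_eq_of_ringEquiv (R := R ⧸ Ideal.ofList gs') (S := Localization.AtPrime Q) e₁, hq,
    hhs'_def, List.length_map]
  have h : hs.length + gs.length = n := by omega
  exact_mod_cast h

/-- **CI FEDDER TEST AT A CLOSED POINT, CERTIFICATE FORM** (the one-call theorem a chart certificate of the
CI-CN engine consumes): `(∏ gs)^(p-1) ∉ (a₁^p, …, a_m^p)` together with an s.o.p. certificate `hs ⊆ (aᵢ)`,
`|gs| + |hs| = n`, `(aᵢ)^N ⊆ (gs ++ hs)` ⇒ the local ring `(k[y] ⧸ (gs))_Q` at the closed point `Q` over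
`(aᵢ)` satisfies the per-stalk clause of the crux. [cite: Fedder1983, Prop. 1.7, Thm. 1.12 and Prop. 2.1] -/
theorem ci_fedderAtMaximalIdeal_of_certificate : ∀ (p : ℕ) [Fact p.Prime] (k : Type) [Field k] [CharP k p]
    (n m : ℕ) (a : Fin m → MvPolynomial (Fin n) k) (gs hs : List (MvPolynomial (Fin n) k))
    (Q : Ideal (MvPolynomial (Fin n) k ⧸ Ideal.ofList gs)) [Q.IsMaximal],
    Q.comap (Ideal.Quotient.mk (Ideal.ofList gs)) = Ideal.span (Set.range a) →
    gs.prod ^ (p - 1) ∉ Ideal.span (Set.range fun i : Fin m => a i ^ p) →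
    (∀ h ∈ hs, h ∈ Ideal.span (Set.range a)) → gs.length + hs.length = n →
    (∃ N : ℕ, Ideal.span (Set.range a) ^ N ≤ Ideal.ofList (gs ++ hs)) →
    ∀ d : ℕ, ringKrullDim (Localization.AtPrime Q) = d → ∀ s : Fin d → Localization.AtPrime Q,
      (Ideal.span (Set.range s)).radical.IsMaximal →
        RingTheory.Sequence.IsWeaklyRegular (Localization.AtPrime Q) (List.ofFn s) ∧
        ∀ y : Localization.AtPrime Q, (∃ e : ℕ, y ^ p ^ e ∈ Ideal.span
          ((fun z : Localization.AtPrime Q => z ^ p ^ e) ''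
            (Ideal.span (Set.range s) : Set (Localization.AtPrime Q)))) → y ∈ Ideal.span (Set.range s) := by
  intro p _ k _ _ n m a gs hs Q _ hQ hfed hhs hlen hN
  obtain ⟨N, hN⟩ := hN
  exact ci_fedderAtMaximalIdeal k n m p a gs Q hQ hfed
    (ringKrullDim_stalk_add_length_of_sop_certificate k n m a gs hs Q hQ hhs hlen N hN)

end MaximalIdeal

end Summit.ResolutionOfSingularities.ResolutionOfSingularities.Theorems.FInjectiveMacaulayfication.CIFedderAtMaximalIdeal
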